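import Summits.HubbardSuperconductivity.HubbardSuperconductivity.Theorems.FunctionFieldCertificateAssemblyFejerGlue
import Summits.HubbardSuperconductivity.HubbardSuperconductivity.Theorems.FunctionFieldCertificateCertificateSoundness
import Summits.HubbardSuperconductivity.HubbardSuperconductivity.Theorems.FunctionFieldCertificateCertificateCompleteness

/-!
# Route `FunctionFieldCertificate` — the target `CertifiedSectorLRO` (stmt-HubbardSuperconductivity-7330): semantic content and reduction to the cruxes

Supports item `stmt-HubbardSuperconductivity-7330` (the route's TARGET: at one `(U, δ)`, for every large
even `L`, an evaluated certificate `L⁻⁴ Δ_dᴴ Δ_d − (a − C/L)·1 = Σ Oᵢᴴ Oᵢ + Σ Qᵢᴴ (H Qᵢ − Qᵢ H) +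
(H R − R H) + T` with sector-preserving `Qᵢ` and a sector-null `T`). The target is summit-strength and is
not settled here; this file pins down exactly what it says and what it needs:

* `uniformPairOrder_of_certifiedSectorLRO` — SOUNDNESS CONTENT: the certificate forces, at its own
  `(U, δ)`, a uniform every-ground-state floor `a/2 ≤ Re⟨ψ, Δ_dᴴ Δ_d ψ⟩/L⁴` at all large even sides
  (evaluate the identity in a normalised sector ground state, `le_re_of_certificate`; absorb `C/L ≤ a/2`);
* `certifiedSectorLRO_iff_uniformPairOrder` — with the route's `CertificateCompleteness`
  (`certificateCompleteness_proof`, stmt-7334) the typed target is EQUIVALENT to uniform `d`-wave pair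
  order in every `(N_L, S^z = 0)` ground state at one coupling and doping (the route review's reading of
  the target, now a Lean fact);
* `uniformPairOrder_of_meso_window` — the two cruxes deliver exactly that: `MesoscopicPairOrder`
  (pole-free half, stmt-7331) and `WindowInfraredBound` (pole half, stmt-1089) give the floor `m/2` at the
  `(U, δ)` of `MesoscopicPairOrder`, by the fixed-side Fejér glue `FunctionFieldCertificateAssembly.fejer_glue`
  (tent identity + block Plancherel + kernel bounds) with `ε = min ε₀ (m/(4(C+1)))`,
  `R² ≥ 8π²C_d²/(mε²)`, `L ≥ max (max L₁ L₂) (2R)`;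
* `certifiedSectorLRO_of_cruxes` — hence `MesoscopicPairOrder → WindowInfraredBound → CertifiedSectorLRO`:
  the target is reduced to the route's two open cruxes (and, conversely, implies the summit by
  `certificateSoundness_proof`).

Kennedy–Lieb–Shastry, PRL 61 (1988) 2582 (Parseval bookkeeping); Dyson–Lieb–Simon (1978) §3
(window/tail split); Tasaki (2020) §2.1–2.2; soundness/completeness of SOS + first-order ground-state
relaxations in the shape of Wang et al. (2024), Fawzi–Fawzi–Scalet (2024). Folklore; no definition is
introduced.
-/

noncomputable section

-- the summit namespace `Summit.HubbardSuperconductivity.HubbardSuperconductivity.…` repeats the problem name by design (D-0017)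
set_option linter.dupNamespace false

namespace Summit.HubbardSuperconductivity.HubbardSuperconductivity.Theorems.FunctionFieldCertificate

open Matrix Finset Filter
open Literature.Probability.LatticeModels Literature.MathematicalPhysics.QuantumLattice
open Summit.HubbardSuperconductivity.HubbardSuperconductivity.Theses.FunctionFieldCertificate
open scoped ComplexOrder

/-! ### Soundness content: the certificate forces uniform sector pair order -/

/-- **The certificate forces uniform sector pair order.** If `CertifiedSectorLRO` holds (at `(U, δ)`
with constants `a > 0`, `C`, `L₀`), then at the same `(U, δ)`, for every even `L ≥ max L₀ ⌈2C/a⌉` and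
every normalised `(N_L, 0)`-sector ground state `ψ` of `hubbardTorus 2 L 1 U`,
`a/2 ≤ Re⟨ψ, Δ_dᴴ Δ_d ψ⟩/L⁴` — literally the antecedent of `CertificateCompleteness`. (Evaluate the
identity in `ψ`: `⟨Oᴴ O⟩ ≥ 0`, `⟨Qᴴ (HQ − QH)⟩ ≥ 0` by the variational principle in the sector,
`⟨HR − RH⟩ = 0`, `⟨T⟩ = 0`; `le_re_of_certificate`.) Tasaki (2020) §2.2; Wang et al. (2024). [folklore] -/
theorem uniformPairOrder_of_certifiedSectorLRO (h : CertifiedSectorLRO) :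
    ∃ U : ℝ, 0 < U ∧ ∃ δ ∈ Set.Ioo (0:ℝ) (1 / 2), ∃ a : ℝ, 0 < a ∧ ∃ L₀ : ℕ, ∀ (L : ℕ) [NeZero L],
      L₀ ≤ L → Even L → ∀ ψ : Fock (Orb (FermionTorus 2 L)), star ψ ⬝ᵥ ψ = 1 →
        IsGroundStateInSector (hubbardTorus 2 L 1 U) (2 * ⌊(1 - δ) * (L : ℝ) ^ 2 / 2⌋₊) 0 ψ →
          a ≤ (star ψ ⬝ᵥ Matrix.mulVec (Matrix.conjTranspose (pairField dWaveFormFactor L) *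
            pairField dWaveFormFactor L) ψ).re / (L : ℝ) ^ 4 := by
  obtain ⟨U, hU, δ, hδ, a, C, ha, L₀, hcert⟩ := h
  refine ⟨U, hU, δ, hδ, a / 2, half_pos ha, max L₀ ⌈2 * C / a⌉₊, ?_⟩
  intro L _ hL hE ψ hψ1 hgs
  obtain ⟨n, m, O, Q, R, T, hQ, hT, hId⟩ := hcert L (le_of_max_le_left hL) hE
  have hH : (hubbardTorus 2 L 1 U).IsHermitian := LiebThm1.hamiltonian_isHermitian _ 1 U
  obtain ⟨hψK, -, hHψ⟩ := hgs
  have hfloor := le_re_of_certificate hH _ _ _ (a - C / (L : ℝ)) O Q R T hQ hT hId hψK hψ1 hHψ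
  have hLpos : (0 : ℝ) < (L : ℝ) := Nat.cast_pos.2 (Nat.pos_of_ne_zero (NeZero.ne L))
  have hL4 : (0 : ℝ) < (L : ℝ) ^ 4 := by positivity
  have hcast : (1 / (L : ℂ) ^ 4) = (((1 / (L : ℝ) ^ 4 : ℝ)) : ℂ) := by push_cast; rfl
  rw [hcast, Complex.re_ofReal_mul, one_div_mul_eq_div] at hfloor
  -- `C / L ≤ a / 2` for `L ≥ ⌈2C/a⌉`
  have hCL : C / (L : ℝ) ≤ a / 2 := by
    rw [div_le_iff₀ hLpos]
    have h1 : ((⌈2 * C / a⌉₊ : ℕ) : ℝ) ≤ (L : ℝ) := by exact_mod_cast le_of_max_le_right hL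
    have h3 : 2 * C / a ≤ (L : ℝ) := (Nat.le_ceil _).trans h1
    rw [div_le_iff₀ ha] at h3
    nlinarith
  linarith

/-- **The target is uniform sector pair order.** `CertifiedSectorLRO` holds iff at some `(U, δ)` every
normalised `(N_L, 0)`-sector ground state has `a ≤ Re⟨ψ, Δ_dᴴ Δ_d ψ⟩/L⁴` for some `a > 0` and all large
even `L` (`uniformPairOrder_of_certifiedSectorLRO` and the route's `certificateCompleteness_proof`).
[folklore] -/
theorem certifiedSectorLRO_iff_uniformPairOrder :
    CertifiedSectorLRO ↔
      ∃ U : ℝ, 0 < U ∧ ∃ δ ∈ Set.Ioo (0:ℝ) (1 / 2), ∃ a : ℝ, 0 < a ∧ ∃ L₀ : ℕ, ∀ (L : ℕ) [NeZero L],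
        L₀ ≤ L → Even L → ∀ ψ : Fock (Orb (FermionTorus 2 L)), star ψ ⬝ᵥ ψ = 1 →
          IsGroundStateInSector (hubbardTorus 2 L 1 U) (2 * ⌊(1 - δ) * (L : ℝ) ^ 2 / 2⌋₊) 0 ψ →
            a ≤ (star ψ ⬝ᵥ Matrix.mulVec (Matrix.conjTranspose (pairField dWaveFormFactor L) *
              pairField dWaveFormFactor L) ψ).re / (L : ℝ) ^ 4 :=
  ⟨uniformPairOrder_of_certifiedSectorLRO, fun h => certificateCompleteness_proof h⟩

/-! ### The two cruxes deliver uniform sector pair order -/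

/-- The strict momentum window is contained in the closed one and the pair structure factor is
nonnegative: `Σ_{m ≠ 0, |q_m|² < ε²} S_ψ(m) ≤ Σ_m [m ≠ 0 ∧ |q_m|² ≤ ε²] S_ψ(m)`. [folklore] -/
theorem sum_filter_lt_le_sum_ite_le (L : ℕ) [NeZero L] (ε : ℝ)
    (ψ : Fock (Orb (FermionTorus 2 L))) :
    (∑ m ∈ (Finset.univ.filter fun m : TorusSite 2 L => m ≠ 0 ∧ momentumNormSq L m < ε ^ 2),
        pairStructureFactor dWaveFormFactor L ψ m) ≤
      ∑ m : TorusSite 2 L, (if m ≠ 0 ∧ momentumNormSq L m ≤ ε ^ 2 then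
        pairStructureFactor dWaveFormFactor L ψ m else 0) := by
  rw [Finset.sum_filter]
  refine Finset.sum_le_sum fun m _ => ?_
  by_cases h : m ≠ 0 ∧ momentumNormSq L m < ε ^ 2
  · rw [if_pos h, if_pos ⟨h.1, h.2.le⟩]
  · rw [if_neg h]
    split_ifs
    · exact pairStructureFactor_nonneg _ _ _ _
    · exact le_rfl

/-- **The two halves give uniform pair order.** `MesoscopicPairOrder` (Fejér-box `d`-wave pair
correlation `≥ m R²·L²` at arbitrarily large scales `R`, every sector ground state, one `(U, δ)`) and
`WindowInfraredBound` (window pair weight `≤ CεL²`) imply: at that `(U, δ)`, for all large even `L`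
and EVERY normalised `(N_L, 0)`-sector ground state `ψ`, `m/2 ≤ Re⟨ψ, Δ_dᴴ Δ_d ψ⟩/L⁴` — the
antecedent of `CertificateCompleteness`, verbatim. Constants: `ε := min ε₀ (m/(4(C+1)))`,
`R ≥ ⌈8π²C_d²/(mε²)⌉₊ + 1` from `MesoscopicPairOrder`, `L ≥ max (max L₁ L₂) (2R)`.
Kennedy–Lieb–Shastry (1988); Dyson–Lieb–Simon (1978) §3. [folklore] -/
theorem uniformPairOrder_of_meso_window (hM : MesoscopicPairOrder) (hW : WindowInfraredBound) :
    ∃ U : ℝ, 0 < U ∧ ∃ δ ∈ Set.Ioo (0:ℝ) (1 / 2), ∃ a : ℝ, 0 < a ∧ ∃ L₀ : ℕ, ∀ (L : ℕ) [NeZero L],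
      L₀ ≤ L → Even L → ∀ ψ : Fock (Orb (FermionTorus 2 L)), star ψ ⬝ᵥ ψ = 1 →
        IsGroundStateInSector (hubbardTorus 2 L 1 U) (2 * ⌊(1 - δ) * (L : ℝ) ^ 2 / 2⌋₊) 0 ψ →
          a ≤ (star ψ ⬝ᵥ Matrix.mulVec (Matrix.conjTranspose (pairField dWaveFormFactor L) *
            pairField dWaveFormFactor L) ψ).re / (L : ℝ) ^ 4 := by
  obtain ⟨U, hU, δ, hδ, m, hm, hR⟩ := hM
  obtain ⟨C, ε₀, hC, hε₀, L₁, hWin⟩ := hW U hU δ hδ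
  -- the constants
  set Cd : ℝ := ∑ e ∈ insert (0 : Site 2) unitSteps, ‖((dWaveFormFactor e / Real.sqrt 2 : ℝ) : ℂ)‖ * 2
    with hCd
  set ε : ℝ := min ε₀ (m / (4 * (C + 1))) with hε
  have hεpos : 0 < ε := lt_min hε₀ (by positivity)
  have hεle : ε ≤ ε₀ := min_le_left _ _
  have hCε : C * ε ≤ m / 4 := by
    have h1 : ε ≤ m / (4 * (C + 1)) := min_le_right _ _
    have h2 : C * ε ≤ C * (m / (4 * (C + 1))) := mul_le_mul_of_nonneg_left h1 hC
    have h3 : C * (m / (4 * (C + 1))) ≤ m / 4 := by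
      rw [mul_div_assoc']
      rw [div_le_div_iff₀ (by positivity) (by positivity)]
      nlinarith
    exact h2.trans h3
  set B : ℝ := 8 * Real.pi ^ 2 * Cd ^ 2 / (m * ε ^ 2) with hB
  have hBnn : 0 ≤ B := by positivity
  obtain ⟨R, hRR₀, L₂, hMeso⟩ := hR (⌈B⌉₊ + 1)
  have hR1 : 1 ≤ R := le_trans (Nat.le_add_left 1 _) hRR₀
  have hRpos : 0 < R := hR1
  have hRreal : (0 : ℝ) < R := Nat.cast_pos.2 hRpos
  have hBR : B ≤ (R : ℝ) ^ 2 := by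
    have h1 : B ≤ ⌈B⌉₊ := Nat.le_ceil B
    have h2 : ((⌈B⌉₊ + 1 : ℕ) : ℝ) ≤ R := by exact_mod_cast hRR₀
    have h3 : (R : ℝ) ≤ (R : ℝ) ^ 2 := by
      have : (1 : ℝ) ≤ R := by exact_mod_cast hR1
      nlinarith
    push_cast at h2
    linarith
  have htail : 2 * Real.pi ^ 2 * Cd ^ 2 / ((R : ℝ) ^ 2 * ε ^ 2) ≤ m / 4 := by
    rw [div_le_div_iff₀ (by positivity) (by positivity)]
    have : 8 * Real.pi ^ 2 * Cd ^ 2 ≤ (R : ℝ) ^ 2 * (m * ε ^ 2) := by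
      have h := mul_le_mul_of_nonneg_right hBR (show (0 : ℝ) ≤ m * ε ^ 2 by positivity)
      rwa [hB, div_mul_cancel₀ _ (by positivity)] at h
    nlinarith
  refine ⟨U, hU, δ, hδ, m / 2, by positivity, max (max L₁ L₂) (2 * R), fun L _ hL hev ψ hψ hgs => ?_⟩
  have hL₁ : L₁ ≤ L := le_trans (le_max_left _ _) (le_trans (le_max_left _ _) hL)
  have hL₂ : L₂ ≤ L := le_trans (le_max_right _ _) (le_trans (le_max_left _ _) hL)
  have hRL : 2 * R ≤ L := le_trans (le_max_right _ _) hL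
  have hLpos : (0 : ℝ) < L := Nat.cast_pos.2 (Nat.pos_of_ne_zero (NeZero.ne L))
  -- the Fejér glue at this side
  have hglue := FunctionFieldCertificateAssembly.fejer_glue dWaveFormFactor L R hRpos hRL ε hεpos ψ hψ
  -- the Fejér-box term is `≥ m`
  have hbox := hMeso L hL₂ hev ψ hψ hgs
  have hbox' : m ≤ (∑ x : TorusSite 2 L, ∑ y : TorusSite 2 L,
      (∏ i : Fin 2, max 0 (1 - |(((y i - x i).valMinAbs : ℤ) : ℝ)| / (R : ℝ))) *
        (star (localPair dWaveFormFactor L x *ᵥ ψ) ⬝ᵥ (localPair dWaveFormFactor L y *ᵥ ψ)).re) /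
          ((R : ℝ) ^ 2 * (L : ℝ) ^ 2) := by
    rw [le_div_iff₀ (by positivity)]
    rw [le_div_iff₀ (by positivity)] at hbox
    linarith
  -- the window term is `≤ C ε`
  have hwin := hWin ε ⟨hεpos, hεle⟩ L hL₁ hev ψ hψ hgs
  have hwin' : (∑ m ∈ (Finset.univ.filter fun m : TorusSite 2 L => m ≠ 0 ∧ momentumNormSq L m < ε ^ 2),
      pairStructureFactor dWaveFormFactor L ψ m) / (L : ℝ) ^ 2 ≤ C * ε := by
    rw [div_le_iff₀ (by positivity)]
    exact (sum_filter_lt_le_sum_ite_le L ε ψ).trans hwin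
  -- assemble
  have key : m / 2 ≤ (expect ((pairField dWaveFormFactor L)ᴴ * pairField dWaveFormFactor L) ψ).re /
      (L : ℝ) ^ 4 := by linarith
  exact key

/-- **The target reduced to the cruxes, modulo completeness.** `CertificateCompleteness` (stmt-7334,
provable-now: finite presentability of the semantic certificate) turns the uniform pair order delivered
by the two halves (`uniformPairOrder_of_meso_window`) into the per-`L` certificates of the target
`CertifiedSectorLRO` (stmt-7330). [folklore] -/
theorem certifiedSectorLRO_of_completeness (hC : CertificateCompleteness) (hM : MesoscopicPairOrder)
    (hW : WindowInfraredBound) : CertifiedSectorLRO :=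
  hC (uniformPairOrder_of_meso_window hM hW)

/-- **The target reduced to the cruxes.** `MesoscopicPairOrder → WindowInfraredBound →
CertifiedSectorLRO`: the two open halves of the route give uniform sector pair order
(`uniformPairOrder_of_meso_window`), and the completeness of the certificate interface
(`certificateCompleteness_proof`, stmt-7334) turns it into the per-`L` certificates of the target. What
remains of stmt-7330 is exactly the two cruxes stmt-7331 and stmt-1089. [folklore] -/
theorem certifiedSectorLRO_of_cruxes (hM : MesoscopicPairOrder) (hW : WindowInfraredBound) :
    CertifiedSectorLRO :=
  certifiedSectorLRO_of_completeness certificateCompleteness_proof hM hW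

end Summit.HubbardSuperconductivity.HubbardSuperconductivity.Theorems.FunctionFieldCertificate
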